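import Summits.SmoothPoincare4.SmoothPoincare4.Theorems.ConvexBisectionPlanarBisectionExistsSeamConnected
import Literature.Geometry.Symplectic.SteinMorsePerturbation
import Literature.Geometry.Symplectic.SteinMorseIndex
import Summits.SmoothPoincare4.SmoothPoincare4.Theorems.ConvexBisectionPlanarBisectionExistsSupport
import Summits.SmoothPoincare4.SmoothPoincare4.Theorems.ConvexBisectionPlanarBisectionRigidityStubEtnyrePlanarAcyclicOfFact

/-!
# `PlanarAcyclicBisectionExists` — support: the Etnyre-free planar deciding pair, relations to the
# sibling items, non-vacuity at `S⁴`

Support for the item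
`Summit.SmoothPoincare4.SmoothPoincare4.Theses.ConvexBisection.PlanarAcyclicBisectionExists`
(stmt-SmoothPoincare4-15088, route ConvexBisection rev 5; requested by the route-choice planner,
evidence `PlanarPairRestate-10512.md` on stmt-SmoothPoincare4-10512): the ∃-body of
`AcyclicBisectionExists` AND `PlanarContactBoundary J₁`.

* §1 `planarAcyclicBisectionExists_iff` — the item over the sibling crux's `Witness`:
  `↔ ∀ M ≃ₕ S⁴, ∃ B : Witness M, B.Acyclic ∧ PlanarContactBoundary B.J₁`.
* §2 relations (pure logic, plus the seam connectedness of
  `Theorems/ConvexBisectionPlanarBisectionExistsSeamConnected.lean`, its Gompf-fact hypothesis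
  supplied from the tree's proved bricks as in `…SeamConnectedHolds.lean`):
  `acyclicBisectionExists_of_planarAcyclicBisectionExists` (15088 ⇒ crux 10508: drop planarity);
  `planarBisectionExists_of_planarAcyclicBisectionExists` (15088 ⇒ 10512: drop acyclicity, the
  connected seam comes for free); conversely `planarAcyclicBisectionExists_of_planarBisectionExists_of_etnyre`
  (10512 ⇒ 15088 MODULO the named fact `Literature.Geometry.Symplectic.EtnyrePlanarFilling`, via the
  landed `stub_etnyrePlanarAcyclicOfFact`) and the resulting `…_iff_…_of_etnyre`;
  `planarAcyclicBisectionRigidity_of_acyclicBisectionRigidity` (crux 10507 ⇒ crux 15086).  The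
  forgetful map 10511 ⇒ 15086 is the already-landed
  `PlanarBisectionRigidity.planarAcyclic_of_planarBisectionRigidity`
  (`Theorems/ConvexBisectionPlanarBisectionRigidityReduction.lean`) and is not repeated here.
* §3 **the Etnyre-free planar deciding pair**: `smoothPoincare4_of_planarAcyclic_pair :
  PlanarAcyclicBisectionExists → PlanarAcyclicBisectionRigidity → SmoothPoincare4` (the same two
  lines as the route's `closes`), `planarAcyclicBisectionRigidity_of_smoothPoincare4`.
* §4 non-vacuity and tightness modulo the planarity `hP : PlanarContactBoundary
  steinStructureClosedBall` of the standard contact `S³` (proved in the standing disprover's work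
  file of crux PlanarBisectionRigidity, not yet a Theorems module): `exists_acyclic_planar_sphere_of`
  (hemispheres of `S⁴`: contractible, hence ℚ-acyclic, standard Stein balls),
  `exists_acyclic_planar_of_diffeomorph`, `planarAcyclicBisectionExists_of_smoothPoincare4_of`,
  `not_smoothPoincare4_of_not_planarAcyclicBisectionExists_of`,
  `smoothPoincare4_iff_planarAcyclic_pair_of` — the pair carries no slack.
-/

noncomputable section

-- the prescribed namespace `Summit.<P>.<Sub>.…` duplicates `SmoothPoincare4` (P = Sub)
set_option linter.dupNamespace false

open scoped Manifold ContDiff Topology ContinuousMap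
open Set Function CategoryTheory CategoryTheory.Limits
open Literature.Geometry.Symplectic Literature.Topology.FourManifolds
open Literature.AlgebraicTopology.SingularHomology

namespace Summit.SmoothPoincare4.SmoothPoincare4.Theorems.PlanarAcyclicBisectionExists

open Summit.SmoothPoincare4.SmoothPoincare4.Theses.ConvexBisection
open Summit.SmoothPoincare4.SmoothPoincare4.Theorems.AcyclicBisectionExists.Negative
open Summit.SmoothPoincare4.SmoothPoincare4.Theorems.ContractibleTwistedDoubleStandard.Negative
open Summit.SmoothPoincare4.SmoothPoincare4.Theorems.PlanarBisectionExists

/-! ## §1 The item over witnesses -/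

/-- **The item, unfolded**: `PlanarAcyclicBisectionExists ↔` every smooth `M ≃ₕ S⁴` carries a
witness (a Stein bisection along a common contact seam) with ℚ-acyclic halves whose first Stein
structure has planar contact boundary. [folklore] -/
theorem planarAcyclicBisectionExists_iff :
    PlanarAcyclicBisectionExists ↔
      ∀ (M : Type) [TopologicalSpace M] [T2Space M] [SecondCountableTopology M]
        [ChartedSpace (EuclideanSpace ℝ (Fin 4)) M] [IsManifold (𝓡 4) ∞ M],
        M ≃ₕ (Metric.sphere (0 : EuclideanSpace ℝ (Fin 5)) 1) →
          ∃ B : Witness M, B.Acyclic ∧ PlanarContactBoundary B.J₁ := by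
  constructor
  · intro h M _ _ _ _ _ f
    obtain ⟨W₁, _, _, _, _, W₂, _, _, _, _, J₁, J₂, e₁, e₂, h1, h2, h3, h4, h5, h6, h7, h8⟩ :=
      h M f
    exact ⟨⟨W₁, W₂, J₁, J₂, e₁, e₂, h1, h2, h3, h4, h5, h6⟩, h7, h8⟩
  · intro h M _ _ _ _ _ f
    obtain ⟨B, hA, hP⟩ := h M f
    exact ⟨B.W₁, inferInstance, inferInstance, inferInstance, inferInstance, B.W₂, inferInstance,
      inferInstance, inferInstance, inferInstance, B.J₁, B.J₂, B.e₁, B.e₂, B.emb₁, B.emb₂, B.cover,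
      B.inter₁, B.inter₂, B.contact, hA, hP⟩

/-! ## §2 Relations to the sibling items -/

/-- **15088 ⇒ crux `AcyclicBisectionExists`** (stmt-SmoothPoincare4-10508): drop planarity.
[folklore] -/
theorem acyclicBisectionExists_of_planarAcyclicBisectionExists (h : PlanarAcyclicBisectionExists) :
    AcyclicBisectionExists := by
  rw [acyclicBisectionExists_iff]
  intro M _ _ _ _ _ e
  obtain ⟨B, hA, -⟩ := planarAcyclicBisectionExists_iff.1 h M e
  exact ⟨B, hA⟩

/-- **15088 ⇒ `PlanarBisectionExists`** (stmt-SmoothPoincare4-10512), UNCONDITIONALLY: drop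
acyclicity; the connectedness of the seam demanded by 10512 is automatic for every witness over
a homotopy 4-sphere (`isConnected_seam_of_homotopyEquiv`, unconditionally).  (The converse is Etnyre 2004,
Thm. 4.1 + Mayer–Vietoris, kept out of the cone.) [folklore] -/
theorem planarBisectionExists_of_planarAcyclicBisectionExists (h : PlanarAcyclicBisectionExists) :
    PlanarBisectionExists := by
  rw [planarBisectionExists_iff]
  intro M _ _ _ _ _ e
  obtain ⟨B, -, hP⟩ := planarAcyclicBisectionExists_iff.1 h M e
  refine ⟨B, hP, isConnected_seam_of_homotopyEquiv (fun W _ _ _ _ _ _ hW => ?_) e B⟩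
  -- Gompf 1998, Thm. 1.3 (a), from the tree's proved bricks
  obtain ⟨S⟩ := hW
  obtain ⟨g, hg, hconv⟩ := S.exists_isMorseAdapted_levi_pos
  exact S.isHandlebodyOfIndexLE_two_of_isMorseAdapted hg hconv

/-- **Crux `AcyclicBisectionRigidity` ⇒ crux `PlanarAcyclicBisectionRigidity`**
(stmt-SmoothPoincare4-10507 ⇒ 15086): the planar-acyclic crux is a sector of the acyclic one
(forget planarity in the hypothesis). [folklore] -/
theorem planarAcyclicBisectionRigidity_of_acyclicBisectionRigidity (h : AcyclicBisectionRigidity) :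
    PlanarAcyclicBisectionRigidity := by
  intro M _ _ _ _ _ e hM
  obtain ⟨W₁, _, _, _, _, W₂, _, _, _, _, J₁, J₂, e₁, e₂, h1, h2, h3, h4, h5, h6, h7, -⟩ := hM
  let B : Witness M := ⟨W₁, W₂, J₁, J₂, e₁, e₂, h1, h2, h3, h4, h5, h6⟩
  exact h M e ⟨B.W₁, inferInstance, inferInstance, inferInstance, inferInstance, B.W₂,
    inferInstance, inferInstance, inferInstance, inferInstance, B.J₁, B.J₂, B.e₁, B.e₂, B.emb₁,
    B.emb₂, B.cover, B.inter₁, B.inter₂, B.contact, h7⟩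

/-- **10512 ⇒ 15088 modulo Etnyre 2004, Thm. 4.1**: given the named fact `EtnyrePlanarFilling`
(clauses (i) `∂W ↪ W` injective on `H₀(·; ℚ)`, (ii) `H₂(∂W; ℚ) → H₂(W; ℚ)` zero, for compact Stein
domains with planar contact boundary), the halves of every planar common-contact Stein bisection of
a homotopy 4-sphere are ℚ-acyclic in positive degrees (landed `stub_etnyrePlanarAcyclicOfFact`),
so `PlanarBisectionExists → PlanarAcyclicBisectionExists`. CONDITIONAL on the fact.
[cite: Etnyre2004, Thm. 4.1] -/
theorem planarAcyclicBisectionExists_of_planarBisectionExists_of_etnyre (hEt : EtnyrePlanarFilling)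
    (h : PlanarBisectionExists) : PlanarAcyclicBisectionExists := by
  rw [planarAcyclicBisectionExists_iff]
  intro M _ _ _ _ _ e
  obtain ⟨B, hP, -⟩ := planarBisectionExists_iff.1 h M e
  exact ⟨B, PlanarBisectionRigidity.SeamWalkOneSidedBall.stub_etnyrePlanarAcyclicOfFact hEt M e
    B.W₁ B.W₂ B.J₁ B.J₂ B.e₁ B.e₂ B.emb₁ B.emb₂ B.cover B.inter₁ B.inter₂ B.contact hP, hP⟩

/-- **15088 ↔ 10512 modulo Etnyre**: the planar-acyclic support item and `PlanarBisectionExists`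
are equivalent given `EtnyrePlanarFilling` (the unconditional direction is
`planarBisectionExists_of_planarAcyclicBisectionExists`). [cite: Etnyre2004, Thm. 4.1] -/
theorem planarAcyclicBisectionExists_iff_planarBisectionExists_of_etnyre (hEt : EtnyrePlanarFilling) :
    PlanarAcyclicBisectionExists ↔ PlanarBisectionExists :=
  ⟨planarBisectionExists_of_planarAcyclicBisectionExists,
    planarAcyclicBisectionExists_of_planarBisectionExists_of_etnyre hEt⟩

/-! ## §3 The Etnyre-free planar deciding pair -/

/-- **The planar-acyclic pair decides the summit**: `PlanarAcyclicBisectionExists →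
PlanarAcyclicBisectionRigidity → SmoothPoincare4` — the same two lines as the route's `closes`
(the hypothesis of the crux is verbatim the ∃-body of the support item). [folklore] -/
theorem smoothPoincare4_of_planarAcyclic_pair (hE : PlanarAcyclicBisectionExists)
    (hR : PlanarAcyclicBisectionRigidity) : _root_.SmoothPoincare4 := by
  intro M _ _ _ _ _ e
  exact hR M e (hE M e)

/-- The rigidity half is implied by the summit (its conclusion is the summit's). [folklore] -/
theorem planarAcyclicBisectionRigidity_of_smoothPoincare4 (hs : _root_.SmoothPoincare4) :
    PlanarAcyclicBisectionRigidity := by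
  intro M _ _ _ _ _ e _
  exact hs M ‹_› ‹_› e

/-! ## §4 Non-vacuity at `S⁴` and tightness (modulo the planarity of the standard contact `S³`) -/

/-- **The round `S⁴` carries an acyclic planar witness** (modulo `hP`): the hemisphere bisection by
two standard Stein balls (sibling `crux_hypotheses_at_sphere`), the balls contractible hence
ℚ-acyclic in positive degrees, planarity of `(S³, ξ_std)` being `hP`. [folklore] -/
theorem exists_acyclic_planar_sphere_of (hP : PlanarContactBoundary steinStructureClosedBall) :
    ∃ B : Witness (Metric.sphere (0 : EuclideanSpace ℝ (Fin 5)) 1),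
      B.Acyclic ∧ PlanarContactBoundary B.J₁ := by
  obtain ⟨e₁, e₂, h1, h2, h3, h4, h5, h6⟩ := crux_hypotheses_at_sphere
  haveI : ContractibleSpace (Metric.closedBall (0 : EuclideanSpace ℝ (Fin 4)) 1) :=
    contractibleSpace_closedBall_four
  refine ⟨⟨_, _, steinStructureClosedBall, steinStructureClosedBall, e₁, e₂, h1, h2, h3, h4, h5, h6⟩,
    fun k hk => ⟨?_, ?_⟩, hP⟩ <;>
    exact isZero_singularHomology_of_contractibleSpace ℚ ℚ
      (X := (Metric.closedBall (0 : EuclideanSpace ℝ (Fin 4)) 1)) (Nat.pos_iff_ne_zero.1 hk)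

/-- Acyclic planar witnesses transport along diffeomorphisms (the halves and `J₁` do not change).
[folklore] -/
theorem exists_acyclic_planar_of_diffeomorph {M N : Type} [TopologicalSpace M]
    [ChartedSpace (EuclideanSpace ℝ (Fin 4)) M] [IsManifold (𝓡 4) ∞ M] [TopologicalSpace N]
    [ChartedSpace (EuclideanSpace ℝ (Fin 4)) N] [IsManifold (𝓡 4) ∞ N] (Φ : N ≃ₘ⟮𝓡 4, 𝓡 4⟯ M)
    (h : ∃ B : Witness N, B.Acyclic ∧ PlanarContactBoundary B.J₁) :
    ∃ B : Witness M, B.Acyclic ∧ PlanarContactBoundary B.J₁ := by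
  obtain ⟨B, hA, hP⟩ := h
  exact ⟨B.transport Φ, Witness.transport_acyclic hA Φ, hP⟩

/-- **The support item is implied by the summit** (modulo `hP`):
`SmoothPoincare4 → PlanarAcyclicBisectionExists`. [folklore] -/
theorem planarAcyclicBisectionExists_of_smoothPoincare4_of
    (hP : PlanarContactBoundary steinStructureClosedBall) (hs : _root_.SmoothPoincare4) :
    PlanarAcyclicBisectionExists := by
  rw [planarAcyclicBisectionExists_iff]
  intro M _ _ _ _ _ e
  obtain ⟨Φ⟩ := hs M ‹_› ‹_› e
  exact exists_acyclic_planar_of_diffeomorph Φ.symm (exists_acyclic_planar_sphere_of hP)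

/-- … so a refutation of the support item is an exotic 4-sphere (modulo `hP`). [folklore] -/
theorem not_smoothPoincare4_of_not_planarAcyclicBisectionExists_of
    (hP : PlanarContactBoundary steinStructureClosedBall) (h : ¬ PlanarAcyclicBisectionExists) :
    ¬ _root_.SmoothPoincare4 :=
  fun hs => h (planarAcyclicBisectionExists_of_smoothPoincare4_of hP hs)

/-- **No slack in the planar-acyclic pair** (modulo `hP`):
`SmoothPoincare4 ↔ PlanarAcyclicBisectionExists ∧ PlanarAcyclicBisectionRigidity`. [folklore] -/
theorem smoothPoincare4_iff_planarAcyclic_pair_of (hP : PlanarContactBoundary steinStructureClosedBall) :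
    _root_.SmoothPoincare4 ↔ PlanarAcyclicBisectionExists ∧ PlanarAcyclicBisectionRigidity :=
  ⟨fun hs => ⟨planarAcyclicBisectionExists_of_smoothPoincare4_of hP hs,
    planarAcyclicBisectionRigidity_of_smoothPoincare4 hs⟩,
    fun h => smoothPoincare4_of_planarAcyclic_pair h.1 h.2⟩

end Summit.SmoothPoincare4.SmoothPoincare4.Theorems.PlanarAcyclicBisectionExists
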